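import Literature.MathematicalPhysics.QuantumManyBody.OneCoordinateMarginalStabilityAux
import HarnessLib

/-!
# One-coordinate marginals: stability of the slice data in the energy norm

For two finite-energy bosonic trial states `Φ, Ψ` in the Dirichlet box `Λ_L^N` and a coordinate
`p = (i,k)`, the one-coordinate slice data of `OneCoordinateMarginal.lean` — the full slice energy
`e(t) = ∫_{x_p=t}(|∇ψ|² + V|ψ|²)` (`sliceEnergyReal`), the normal slice kinetic energy
`e_t(t) = ∫_{x_p=t}|∂_pψ|²` (`normalSliceEnergyReal`) and the slice current `j(t) = Re∫_{x_p=t} ψ̄ ∂_pψ`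
(`sliceCurrent`) — depend Lipschitz-continuously in `L¹(dt)` on the wave function, measured in the
energy norm `Q(Φ-Ψ) = ∫(|∇(Φ-Ψ)|² + V|Φ-Ψ|²)` and the `L²` distance `M(Φ-Ψ) = ∫|Φ-Ψ|²`
(`E_Φ = energy v Φ`):

* `integral_abs_toReal_energyDensity_sub_le` : `∫ |e_Φ - e_Ψ| dX ≤ √Q · √(2(E_Φ + E_Ψ))` for the real
  energy densities, and `intervalIntegral_abs_sliceEnergyReal_sub_le` :
  `∫ₐᵇ |e_Φ(t) - e_Ψ(t)| dt ≤ √Q · √(2(E_Φ + E_Ψ))`;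
* `integral_abs_norm_fderiv_sq_sub_le`, `intervalIntegral_abs_normalSliceEnergyReal_sub_le` : the same
  bound for `|∂_pψ|²` and for `e_t`;
* `integral_abs_re_conj_mul_fderiv_sub_le`, `intervalIntegral_abs_sliceCurrent_sub_le` :
  `∫ₐᵇ |j_Φ(t) - j_Ψ(t)| dt ≤ √M · √E_Φ + √Q`.

Proofs: pointwise, wherever the three densities are finite (a.e.),
`|e_Φ - e_Ψ| ≤ ∑_q |∂_qΦ - ∂_qΨ|(|∂_qΦ| + |∂_qΨ|) + V|Φ - Ψ|(|Φ| + |Ψ|) ≤ (λ/2) q_{Φ-Ψ} + (e_Φ + e_Ψ)/λ`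
for every `λ > 0`; integrate and optimise `λ` (`integral_abs_le_sqrt_mul_sqrt_of_param` of the `Aux`
file); for the current, `Φ̄∂Φ - Ψ̄∂Ψ = (Φ-Ψ)‾∂Φ + Ψ̄∂(Φ-Ψ)`, Cauchy–Schwarz and `∫|Ψ|² = 1`. The
passage from configuration space to `dt`-integrals of slice data is
`intervalIntegral_abs_slice_sub_slice_le` (Fubini along the coordinate). The potential may be `⊤`
(hard cores). This is the stability input for extracting limits of slice data along minimising
sequences that are Cauchy in the energy norm (crux `RigidMomentumBound`, route `BECTangentRigidity`,
`Summits/AtomisticToContinuum/BoseEinsteinCondensation`). Standard; tagged folklore.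
-/

noncomputable section

namespace Literature.MathematicalPhysics.QuantumManyBody.BoseGas

open _root_.MeasureTheory Filter Set Function
open scoped ENNReal NNReal Topology

variable {N : ℕ}

/-! ### Whole-space stability estimates for two trial states -/

section TwoStates

variable {L : ℝ} {v : ℝ → ℝ≥0∞}

/-- **Energy-norm stability of the energy density**: for finite-energy trial states `Φ, Ψ` with
`Q = ∫(|∇(Φ-Ψ)|² + V|Φ-Ψ|²) < ∞`,
`∫ |e_Φ - e_Ψ| ≤ √Q · √(2(E_Φ + E_Ψ))` for the real energy densities `e = (|∇ψ|² + V|ψ|²).toReal`. [folklore] -/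
theorem integral_abs_toReal_energyDensity_sub_le (hv : Measurable v) (Φ Ψ : TrialState N L)
    (hΦ : energy v Φ ≠ ⊤) (hΨ : energy v Ψ ≠ ⊤)
    (hQ : (∫⁻ X, (kineticDensity (fun X => Φ.ψ X - Ψ.ψ X) X +
        interaction v X * (‖Φ.ψ X - Ψ.ψ X‖₊ : ℝ≥0∞) ^ 2)) ≠ ⊤) :
    (∫ X, |(kineticDensity Φ.ψ X + interaction v X * (‖Φ.ψ X‖₊ : ℝ≥0∞) ^ 2).toReal -
        (kineticDensity Ψ.ψ X + interaction v X * (‖Ψ.ψ X‖₊ : ℝ≥0∞) ^ 2).toReal|) ≤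
      Real.sqrt (∫⁻ X, (kineticDensity (fun X => Φ.ψ X - Ψ.ψ X) X +
          interaction v X * (‖Φ.ψ X - Ψ.ψ X‖₊ : ℝ≥0∞) ^ 2)).toReal *
        Real.sqrt (2 * ((energy v Φ).toReal + (energy v Ψ).toReal)) := by
  have hcΦ := Φ.contDiff.continuous
  have hcΨ := Ψ.contDiff.continuous
  have hcD : Continuous fun X => Φ.ψ X - Ψ.ψ X := hcΦ.sub hcΨ
  have hdΦ : Differentiable ℝ Φ.ψ := Φ.contDiff.differentiable one_ne_zero
  have hdΨ : Differentiable ℝ Ψ.ψ := Ψ.contDiff.differentiable one_ne_zero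
  have hmΦ := measurable_energyDensity hv hcΦ
  have hmΨ := measurable_energyDensity hv hcΨ
  have hmD := measurable_energyDensity hv hcD
  have hiΦ : Integrable fun X =>
      (kineticDensity Φ.ψ X + interaction v X * (‖Φ.ψ X‖₊ : ℝ≥0∞) ^ 2).toReal :=
    integrable_toReal_of_lintegral_ne_top hmΦ.aemeasurable hΦ
  have hiΨ : Integrable fun X =>
      (kineticDensity Ψ.ψ X + interaction v X * (‖Ψ.ψ X‖₊ : ℝ≥0∞) ^ 2).toReal :=
    integrable_toReal_of_lintegral_ne_top hmΨ.aemeasurable hΨ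
  have hiD : Integrable fun X => (kineticDensity (fun X => Φ.ψ X - Ψ.ψ X) X +
      interaction v X * (‖Φ.ψ X - Ψ.ψ X‖₊ : ℝ≥0∞) ^ 2).toReal :=
    integrable_toReal_of_lintegral_ne_top hmD.aemeasurable hQ
  have hIΦ : (∫ X, (kineticDensity Φ.ψ X + interaction v X * (‖Φ.ψ X‖₊ : ℝ≥0∞) ^ 2).toReal) =
      (energy v Φ).toReal := integral_toReal hmΦ.aemeasurable (ae_lt_top hmΦ hΦ)
  have hIΨ : (∫ X, (kineticDensity Ψ.ψ X + interaction v X * (‖Ψ.ψ X‖₊ : ℝ≥0∞) ^ 2).toReal) =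
      (energy v Ψ).toReal := integral_toReal hmΨ.aemeasurable (ae_lt_top hmΨ hΨ)
  have hID : (∫ X, (kineticDensity (fun X => Φ.ψ X - Ψ.ψ X) X +
      interaction v X * (‖Φ.ψ X - Ψ.ψ X‖₊ : ℝ≥0∞) ^ 2).toReal) =
      (∫⁻ X, (kineticDensity (fun X => Φ.ψ X - Ψ.ψ X) X +
        interaction v X * (‖Φ.ψ X - Ψ.ψ X‖₊ : ℝ≥0∞) ^ 2)).toReal :=
    integral_toReal hmD.aemeasurable (ae_lt_top hmD hQ)
  have key := integral_abs_le_sqrt_mul_sqrt_of_param (μ := volume)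
    (D := fun X => (kineticDensity Φ.ψ X + interaction v X * (‖Φ.ψ X‖₊ : ℝ≥0∞) ^ 2).toReal -
        (kineticDensity Ψ.ψ X + interaction v X * (‖Ψ.ψ X‖₊ : ℝ≥0∞) ^ 2).toReal)
    (e := fun X => 2 * ((kineticDensity Φ.ψ X + interaction v X * (‖Φ.ψ X‖₊ : ℝ≥0∞) ^ 2).toReal +
        (kineticDensity Ψ.ψ X + interaction v X * (‖Ψ.ψ X‖₊ : ℝ≥0∞) ^ 2).toReal))
    hiD ((hiΦ.add hiΨ).const_mul 2) (Eventually.of_forall fun X => ENNReal.toReal_nonneg)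
    (Eventually.of_forall fun X => by positivity) ?_
  · rw [integral_const_mul, integral_add hiΦ hiΨ, hIΦ, hIΨ, hID] at key
    exact key
  filter_upwards [ae_interaction_mul_normSq_ne_top hv hcΦ hΦ,
    ae_interaction_mul_normSq_ne_top hv hcΨ hΨ, ae_interaction_mul_normSq_ne_top hv hcD hQ]
    with X h1 h2 h3 l hl
  rw [toReal_energyDensity_eq v _ X h1, toReal_energyDensity_eq v _ X h2,
    toReal_energyDensity_eq v (fun X => Φ.ψ X - Ψ.ψ X) X h3]
  refine two_mul_abs_energy_sub_le_param Finset.univ (fun q => norm_nonneg _)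
    (fun q => norm_nonneg _) (fun q => ?_) ENNReal.toReal_nonneg (norm_nonneg _) (norm_nonneg _)
    (abs_norm_sub_norm_le _ _) hl
  rw [fderiv_fun_sub (hdΦ X) (hdΨ X), sub_apply]
  exact abs_norm_sub_norm_le _ _

/-- **Energy-norm stability of one squared partial derivative**:
`∫ ||∂_pΦ|² - |∂_pΨ|²| ≤ √Q · √(2(E_Φ + E_Ψ))`. [folklore] -/
theorem integral_abs_norm_fderiv_sq_sub_le (hv : Measurable v) (Φ Ψ : TrialState N L)
    (p : Fin N × Fin 3) (hΦ : energy v Φ ≠ ⊤) (hΨ : energy v Ψ ≠ ⊤)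
    (hQ : (∫⁻ X, (kineticDensity (fun X => Φ.ψ X - Ψ.ψ X) X +
        interaction v X * (‖Φ.ψ X - Ψ.ψ X‖₊ : ℝ≥0∞) ^ 2)) ≠ ⊤) :
    (∫ X, |‖fderiv ℝ Φ.ψ X (unitVec p.1 p.2)‖ ^ 2 - ‖fderiv ℝ Ψ.ψ X (unitVec p.1 p.2)‖ ^ 2|) ≤
      Real.sqrt (∫⁻ X, (kineticDensity (fun X => Φ.ψ X - Ψ.ψ X) X +
          interaction v X * (‖Φ.ψ X - Ψ.ψ X‖₊ : ℝ≥0∞) ^ 2)).toReal *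
        Real.sqrt (2 * ((energy v Φ).toReal + (energy v Ψ).toReal)) := by
  have hcΦ := Φ.contDiff.continuous
  have hcΨ := Ψ.contDiff.continuous
  have hcD : Continuous fun X => Φ.ψ X - Ψ.ψ X := hcΦ.sub hcΨ
  have hdΦ : Differentiable ℝ Φ.ψ := Φ.contDiff.differentiable one_ne_zero
  have hdΨ : Differentiable ℝ Ψ.ψ := Ψ.contDiff.differentiable one_ne_zero
  have hmΦ := measurable_energyDensity hv hcΦ
  have hmΨ := measurable_energyDensity hv hcΨ
  have hmD := measurable_energyDensity hv hcD
  have hiΦ : Integrable fun X =>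
      (kineticDensity Φ.ψ X + interaction v X * (‖Φ.ψ X‖₊ : ℝ≥0∞) ^ 2).toReal :=
    integrable_toReal_of_lintegral_ne_top hmΦ.aemeasurable hΦ
  have hiΨ : Integrable fun X =>
      (kineticDensity Ψ.ψ X + interaction v X * (‖Ψ.ψ X‖₊ : ℝ≥0∞) ^ 2).toReal :=
    integrable_toReal_of_lintegral_ne_top hmΨ.aemeasurable hΨ
  have hiD : Integrable fun X => (kineticDensity (fun X => Φ.ψ X - Ψ.ψ X) X +
      interaction v X * (‖Φ.ψ X - Ψ.ψ X‖₊ : ℝ≥0∞) ^ 2).toReal :=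
    integrable_toReal_of_lintegral_ne_top hmD.aemeasurable hQ
  have hIΦ : (∫ X, (kineticDensity Φ.ψ X + interaction v X * (‖Φ.ψ X‖₊ : ℝ≥0∞) ^ 2).toReal) =
      (energy v Φ).toReal := integral_toReal hmΦ.aemeasurable (ae_lt_top hmΦ hΦ)
  have hIΨ : (∫ X, (kineticDensity Ψ.ψ X + interaction v X * (‖Ψ.ψ X‖₊ : ℝ≥0∞) ^ 2).toReal) =
      (energy v Ψ).toReal := integral_toReal hmΨ.aemeasurable (ae_lt_top hmΨ hΨ)
  have hID : (∫ X, (kineticDensity (fun X => Φ.ψ X - Ψ.ψ X) X +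
      interaction v X * (‖Φ.ψ X - Ψ.ψ X‖₊ : ℝ≥0∞) ^ 2).toReal) =
      (∫⁻ X, (kineticDensity (fun X => Φ.ψ X - Ψ.ψ X) X +
        interaction v X * (‖Φ.ψ X - Ψ.ψ X‖₊ : ℝ≥0∞) ^ 2)).toReal :=
    integral_toReal hmD.aemeasurable (ae_lt_top hmD hQ)
  have key := integral_abs_le_sqrt_mul_sqrt_of_param (μ := volume)
    (D := fun X => ‖fderiv ℝ Φ.ψ X (unitVec p.1 p.2)‖ ^ 2 - ‖fderiv ℝ Ψ.ψ X (unitVec p.1 p.2)‖ ^ 2)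
    (e := fun X => 2 * ((kineticDensity Φ.ψ X + interaction v X * (‖Φ.ψ X‖₊ : ℝ≥0∞) ^ 2).toReal +
        (kineticDensity Ψ.ψ X + interaction v X * (‖Ψ.ψ X‖₊ : ℝ≥0∞) ^ 2).toReal))
    hiD ((hiΦ.add hiΨ).const_mul 2) (Eventually.of_forall fun X => ENNReal.toReal_nonneg)
    (Eventually.of_forall fun X => by positivity) ?_
  · rw [integral_const_mul, integral_add hiΦ hiΨ, hIΦ, hIΨ, hID] at key
    exact key
  filter_upwards [ae_interaction_mul_normSq_ne_top hv hcΦ hΦ,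
    ae_interaction_mul_normSq_ne_top hv hcΨ hΨ, ae_interaction_mul_normSq_ne_top hv hcD hQ]
    with X h1 h2 h3 l hl
  rw [toReal_energyDensity_eq v _ X h1, toReal_energyDensity_eq v _ X h2,
    toReal_energyDensity_eq v (fun X => Φ.ψ X - Ψ.ψ X) X h3]
  refine two_mul_abs_sq_sub_sq_le_energy_param Finset.univ
    (a := fun q : Fin N × Fin 3 => ‖fderiv ℝ Φ.ψ X (unitVec q.1 q.2)‖)
    (b := fun q : Fin N × Fin 3 => ‖fderiv ℝ Ψ.ψ X (unitVec q.1 q.2)‖)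
    (c := fun q : Fin N × Fin 3 => ‖fderiv ℝ (fun X => Φ.ψ X - Ψ.ψ X) X (unitVec q.1 q.2)‖)
    (fun q => norm_nonneg _) (fun q => norm_nonneg _) (fun q => ?_) ENNReal.toReal_nonneg hl
    (Finset.mem_univ p)
  rw [fderiv_fun_sub (hdΦ X) (hdΨ X), sub_apply]
  exact abs_norm_sub_norm_le _ _

/-- **Stability of the current density**: with `M = ∫|Φ-Ψ|²`,
`∫ |Re(Φ̄ ∂_pΦ) - Re(Ψ̄ ∂_pΨ)| ≤ √M · √E_Φ + √Q` (from
`Φ̄∂Φ - Ψ̄∂Ψ = (Φ-Ψ)‾∂Φ + Ψ̄ ∂(Φ-Ψ)`, Cauchy–Schwarz and `∫|Ψ|² = 1`). [folklore] -/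
theorem integral_abs_re_conj_mul_fderiv_sub_le (hv : Measurable v) (Φ Ψ : TrialState N L)
    (p : Fin N × Fin 3) (hΦ : energy v Φ ≠ ⊤)
    (hQ : (∫⁻ X, (kineticDensity (fun X => Φ.ψ X - Ψ.ψ X) X +
        interaction v X * (‖Φ.ψ X - Ψ.ψ X‖₊ : ℝ≥0∞) ^ 2)) ≠ ⊤) :
    (∫ X, |RCLike.re (starRingEnd ℂ (Φ.ψ X) * fderiv ℝ Φ.ψ X (unitVec p.1 p.2)) -
        RCLike.re (starRingEnd ℂ (Ψ.ψ X) * fderiv ℝ Ψ.ψ X (unitVec p.1 p.2))|) ≤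
      Real.sqrt (∫⁻ X, (‖Φ.ψ X - Ψ.ψ X‖₊ : ℝ≥0∞) ^ 2).toReal * Real.sqrt (energy v Φ).toReal +
        Real.sqrt (∫⁻ X, (kineticDensity (fun X => Φ.ψ X - Ψ.ψ X) X +
          interaction v X * (‖Φ.ψ X - Ψ.ψ X‖₊ : ℝ≥0∞) ^ 2)).toReal := by
  have _hv := hv
  set e : Config N := unitVec p.1 p.2 with he
  have hcΦ := Φ.contDiff.continuous
  have hcΨ := Ψ.contDiff.continuous
  have hcD : Continuous fun X => Φ.ψ X - Ψ.ψ X := hcΦ.sub hcΨ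
  have hdΦ : Differentiable ℝ Φ.ψ := Φ.contDiff.differentiable one_ne_zero
  have hdΨ : Differentiable ℝ Ψ.ψ := Ψ.contDiff.differentiable one_ne_zero
  have hcdΦ : Continuous fun X => fderiv ℝ Φ.ψ X e :=
    (Φ.contDiff.continuous_fderiv one_ne_zero).clm_apply continuous_const
  have hcdD : Continuous fun X => fderiv ℝ (fun X => Φ.ψ X - Ψ.ψ X) X e :=
    ((Φ.contDiff.sub Ψ.contDiff).continuous_fderiv one_ne_zero).clm_apply continuous_const
  have hsΦ : HasCompactSupport Φ.ψ := Φ.hasCompactSupport'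
  have hsΨ : HasCompactSupport Ψ.ψ := Ψ.hasCompactSupport'
  have hsD : HasCompactSupport fun X => Φ.ψ X - Ψ.ψ X :=
    hsΦ.comp₂_left hsΨ (m := fun a b => a - b) (sub_zero 0)
  -- the two majorants
  have hT1 : Integrable fun X => ‖Φ.ψ X - Ψ.ψ X‖ * ‖fderiv ℝ Φ.ψ X e‖ :=
    integrable_norm_mul_norm_of_hasCompactSupport hcD hcdΦ hsD
  have hT2 : Integrable fun X => ‖Ψ.ψ X‖ * ‖fderiv ℝ (fun X => Φ.ψ X - Ψ.ψ X) X e‖ :=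
    integrable_norm_mul_norm_of_hasCompactSupport hcΨ hcdD hsΨ
  have hpt : ∀ X, |RCLike.re (starRingEnd ℂ (Φ.ψ X) * fderiv ℝ Φ.ψ X e) -
      RCLike.re (starRingEnd ℂ (Ψ.ψ X) * fderiv ℝ Ψ.ψ X e)| ≤
      ‖Φ.ψ X - Ψ.ψ X‖ * ‖fderiv ℝ Φ.ψ X e‖ +
        ‖Ψ.ψ X‖ * ‖fderiv ℝ (fun X => Φ.ψ X - Ψ.ψ X) X e‖ := by
    intro X
    have hsub : fderiv ℝ (fun X => Φ.ψ X - Ψ.ψ X) X e = fderiv ℝ Φ.ψ X e - fderiv ℝ Ψ.ψ X e := by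
      rw [fderiv_fun_sub (hdΦ X) (hdΨ X), sub_apply]
    have hid : starRingEnd ℂ (Φ.ψ X) * fderiv ℝ Φ.ψ X e - starRingEnd ℂ (Ψ.ψ X) * fderiv ℝ Ψ.ψ X e =
        starRingEnd ℂ (Φ.ψ X - Ψ.ψ X) * fderiv ℝ Φ.ψ X e +
          starRingEnd ℂ (Ψ.ψ X) * (fderiv ℝ Φ.ψ X e - fderiv ℝ Ψ.ψ X e) := by
      rw [map_sub]; ring
    rw [← map_sub, hid, map_add, hsub]
    refine (abs_add_le _ _).trans (add_le_add ?_ ?_)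
    · refine (RCLike.abs_re_le_norm _).trans_eq ?_
      rw [norm_mul, Complex.norm_conj]
    · refine (RCLike.abs_re_le_norm _).trans_eq ?_
      rw [norm_mul, Complex.norm_conj]
  -- Cauchy–Schwarz for each majorant
  have hB1 : (∫ X, ‖Φ.ψ X - Ψ.ψ X‖ * ‖fderiv ℝ Φ.ψ X e‖) ≤
      Real.sqrt (∫⁻ X, (‖Φ.ψ X - Ψ.ψ X‖₊ : ℝ≥0∞) ^ 2).toReal * Real.sqrt (energy v Φ).toReal := by
    have k := integral_abs_le_sqrt_mul_sqrt_of_param (μ := volume)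
      (D := fun X => ‖Φ.ψ X - Ψ.ψ X‖ * ‖fderiv ℝ Φ.ψ X e‖)
      (q := fun X => ‖Φ.ψ X - Ψ.ψ X‖ ^ 2) (e := fun X => ‖fderiv ℝ Φ.ψ X e‖ ^ 2)
      (integrable_norm_sq_of_hasCompactSupport hcD hsD)
      (integrable_norm_sq_of_hasCompactSupport hcdΦ (hsΦ.fderiv_apply (𝕜 := ℝ) e))
      (Eventually.of_forall fun X => by positivity) (Eventually.of_forall fun X => by positivity)
      (Eventually.of_forall fun X l hl => two_mul_abs_mul_le_param hl)
    have habs : (fun X => |‖Φ.ψ X - Ψ.ψ X‖ * ‖fderiv ℝ Φ.ψ X e‖|) =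
        fun X => ‖Φ.ψ X - Ψ.ψ X‖ * ‖fderiv ℝ Φ.ψ X e‖ := funext fun X => abs_of_nonneg (by positivity)
    rw [habs] at k
    refine k.trans (mul_le_mul (le_of_eq ?_) (Real.sqrt_le_sqrt ?_) (Real.sqrt_nonneg _)
      (Real.sqrt_nonneg _))
    · rw [integral_norm_sq_config_eq_toReal (fun X => Φ.ψ X - Ψ.ψ X) hcD.aestronglyMeasurable]
    · exact integral_norm_fderiv_sq_le_toReal v Φ.ψ p hΦ
  have hB2 : (∫ X, ‖Ψ.ψ X‖ * ‖fderiv ℝ (fun X => Φ.ψ X - Ψ.ψ X) X e‖) ≤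
      Real.sqrt (∫⁻ X, (kineticDensity (fun X => Φ.ψ X - Ψ.ψ X) X +
          interaction v X * (‖Φ.ψ X - Ψ.ψ X‖₊ : ℝ≥0∞) ^ 2)).toReal := by
    have k := integral_abs_le_sqrt_mul_sqrt_of_param (μ := volume)
      (D := fun X => ‖Ψ.ψ X‖ * ‖fderiv ℝ (fun X => Φ.ψ X - Ψ.ψ X) X e‖)
      (q := fun X => ‖Ψ.ψ X‖ ^ 2) (e := fun X => ‖fderiv ℝ (fun X => Φ.ψ X - Ψ.ψ X) X e‖ ^ 2)
      (integrable_norm_sq_of_hasCompactSupport hcΨ hsΨ)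
      (integrable_norm_sq_of_hasCompactSupport hcdD (hsD.fderiv_apply (𝕜 := ℝ) e))
      (Eventually.of_forall fun X => by positivity) (Eventually.of_forall fun X => by positivity)
      (Eventually.of_forall fun X l hl => two_mul_abs_mul_le_param hl)
    have habs : (fun X => |‖Ψ.ψ X‖ * ‖fderiv ℝ (fun X => Φ.ψ X - Ψ.ψ X) X e‖|) =
        fun X => ‖Ψ.ψ X‖ * ‖fderiv ℝ (fun X => Φ.ψ X - Ψ.ψ X) X e‖ :=
      funext fun X => abs_of_nonneg (by positivity)
    rw [habs, integral_norm_sq_config_eq_toReal Ψ.ψ hcΨ.aestronglyMeasurable, Ψ.norm_eq,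
      ENNReal.toReal_one, Real.sqrt_one, one_mul] at k
    exact k.trans (Real.sqrt_le_sqrt (integral_norm_fderiv_sq_le_toReal v _ p hQ))
  calc (∫ X, |RCLike.re (starRingEnd ℂ (Φ.ψ X) * fderiv ℝ Φ.ψ X e) -
          RCLike.re (starRingEnd ℂ (Ψ.ψ X) * fderiv ℝ Ψ.ψ X e)|)
      ≤ ∫ X, (‖Φ.ψ X - Ψ.ψ X‖ * ‖fderiv ℝ Φ.ψ X e‖ +
          ‖Ψ.ψ X‖ * ‖fderiv ℝ (fun X => Φ.ψ X - Ψ.ψ X) X e‖) :=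
        integral_mono_of_nonneg (Eventually.of_forall fun X => abs_nonneg _) (hT1.add hT2)
          (Eventually.of_forall hpt)
    _ = (∫ X, ‖Φ.ψ X - Ψ.ψ X‖ * ‖fderiv ℝ Φ.ψ X e‖) +
          ∫ X, ‖Ψ.ψ X‖ * ‖fderiv ℝ (fun X => Φ.ψ X - Ψ.ψ X) X e‖ := integral_add hT1 hT2
    _ ≤ _ := add_le_add hB1 hB2

/-! ### `L¹(dt)`-stability of the slice data -/

/-- **The full slice energy is `L¹(dt)`-Lipschitz in the energy norm**:
`∫ₐᵇ |e_Φ(t) - e_Ψ(t)| dt ≤ √Q · √(2(E_Φ + E_Ψ))`. [folklore] -/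
theorem intervalIntegral_abs_sliceEnergyReal_sub_le (hv : Measurable v) (Φ Ψ : TrialState N L)
    (p : Fin N × Fin 3) (hΦ : energy v Φ ≠ ⊤) (hΨ : energy v Ψ ≠ ⊤)
    (hQ : (∫⁻ X, (kineticDensity (fun X => Φ.ψ X - Ψ.ψ X) X +
        interaction v X * (‖Φ.ψ X - Ψ.ψ X‖₊ : ℝ≥0∞) ^ 2)) ≠ ⊤) {a b : ℝ} (hab : a ≤ b) :
    (∫ t in a..b, |sliceEnergyReal v Φ.ψ p t - sliceEnergyReal v Ψ.ψ p t|) ≤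
      Real.sqrt (∫⁻ X, (kineticDensity (fun X => Φ.ψ X - Ψ.ψ X) X +
          interaction v X * (‖Φ.ψ X - Ψ.ψ X‖₊ : ℝ≥0∞) ^ 2)).toReal *
        Real.sqrt (2 * ((energy v Φ).toReal + (energy v Ψ).toReal)) := by
  have hiΦ : Integrable fun X =>
      (kineticDensity Φ.ψ X + interaction v X * (‖Φ.ψ X‖₊ : ℝ≥0∞) ^ 2).toReal :=
    integrable_toReal_of_lintegral_ne_top
      (measurable_energyDensity hv Φ.contDiff.continuous).aemeasurable hΦ
  have hiΨ : Integrable fun X =>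
      (kineticDensity Ψ.ψ X + interaction v X * (‖Ψ.ψ X‖₊ : ℝ≥0∞) ^ 2).toReal :=
    integrable_toReal_of_lintegral_ne_top
      (measurable_energyDensity hv Ψ.contDiff.continuous).aemeasurable hΨ
  exact (intervalIntegral_abs_slice_sub_slice_le p hiΦ hiΨ hab).trans
    (integral_abs_toReal_energyDensity_sub_le hv Φ Ψ hΦ hΨ hQ)

/-- **The normal slice kinetic energy is `L¹(dt)`-Lipschitz in the energy norm**:
`∫ₐᵇ |e_{t,Φ}(t) - e_{t,Ψ}(t)| dt ≤ √Q · √(2(E_Φ + E_Ψ))`. [folklore] -/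
theorem intervalIntegral_abs_normalSliceEnergyReal_sub_le (hv : Measurable v)
    (Φ Ψ : TrialState N L) (p : Fin N × Fin 3) (hΦ : energy v Φ ≠ ⊤) (hΨ : energy v Ψ ≠ ⊤)
    (hQ : (∫⁻ X, (kineticDensity (fun X => Φ.ψ X - Ψ.ψ X) X +
        interaction v X * (‖Φ.ψ X - Ψ.ψ X‖₊ : ℝ≥0∞) ^ 2)) ≠ ⊤) {a b : ℝ} (hab : a ≤ b) :
    (∫ t in a..b, |normalSliceEnergyReal Φ.ψ p t - normalSliceEnergyReal Ψ.ψ p t|) ≤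
      Real.sqrt (∫⁻ X, (kineticDensity (fun X => Φ.ψ X - Ψ.ψ X) X +
          interaction v X * (‖Φ.ψ X - Ψ.ψ X‖₊ : ℝ≥0∞) ^ 2)).toReal *
        Real.sqrt (2 * ((energy v Φ).toReal + (energy v Ψ).toReal)) := by
  have hi : ∀ Θ : TrialState N L, Integrable fun X => ‖fderiv ℝ Θ.ψ X (unitVec p.1 p.2)‖ ^ 2 :=
    fun Θ => integrable_norm_sq_of_hasCompactSupport
      ((Θ.contDiff.continuous_fderiv one_ne_zero).clm_apply continuous_const)
      (Θ.hasCompactSupport'.fderiv_apply (𝕜 := ℝ) _)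
  exact (intervalIntegral_abs_slice_sub_slice_le p (hi Φ) (hi Ψ) hab).trans
    (integral_abs_norm_fderiv_sq_sub_le hv Φ Ψ p hΦ hΨ hQ)

/-- **The slice current is `L¹(dt)`-Lipschitz** (energy norm and `L²` distance `M = ∫|Φ-Ψ|²`):
`∫ₐᵇ |j_Φ(t) - j_Ψ(t)| dt ≤ √M · √E_Φ + √Q`. [folklore] -/
theorem intervalIntegral_abs_sliceCurrent_sub_le (hv : Measurable v) (Φ Ψ : TrialState N L)
    (p : Fin N × Fin 3) (hΦ : energy v Φ ≠ ⊤)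
    (hQ : (∫⁻ X, (kineticDensity (fun X => Φ.ψ X - Ψ.ψ X) X +
        interaction v X * (‖Φ.ψ X - Ψ.ψ X‖₊ : ℝ≥0∞) ^ 2)) ≠ ⊤) {a b : ℝ} (hab : a ≤ b) :
    (∫ t in a..b, |sliceCurrent Φ.ψ p t - sliceCurrent Ψ.ψ p t|) ≤
      Real.sqrt (∫⁻ X, (‖Φ.ψ X - Ψ.ψ X‖₊ : ℝ≥0∞) ^ 2).toReal * Real.sqrt (energy v Φ).toReal +
        Real.sqrt (∫⁻ X, (kineticDensity (fun X => Φ.ψ X - Ψ.ψ X) X +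
          interaction v X * (‖Φ.ψ X - Ψ.ψ X‖₊ : ℝ≥0∞) ^ 2)).toReal := by
  have hi : ∀ Θ : TrialState N L, Integrable fun X =>
      RCLike.re (starRingEnd ℂ (Θ.ψ X) * fderiv ℝ Θ.ψ X (unitVec p.1 p.2)) := by
    intro Θ
    have hc : Continuous fun X =>
        RCLike.re (starRingEnd ℂ (Θ.ψ X) * fderiv ℝ Θ.ψ X (unitVec p.1 p.2)) :=
      RCLike.continuous_re.comp ((Complex.continuous_conj.comp Θ.contDiff.continuous).mul
        ((Θ.contDiff.continuous_fderiv one_ne_zero).clm_apply continuous_const))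
    have hs : HasCompactSupport fun X =>
        RCLike.re (starRingEnd ℂ (Θ.ψ X) * fderiv ℝ Θ.ψ X (unitVec p.1 p.2)) :=
      Θ.hasCompactSupport'.comp₂_left (Θ.hasCompactSupport'.fderiv_apply (𝕜 := ℝ) _)
        (m := fun a b => RCLike.re (starRingEnd ℂ a * b)) (by simp)
    exact hc.integrable_of_hasCompactSupport hs
  exact (intervalIntegral_abs_slice_sub_slice_le p (hi Φ) (hi Ψ) hab).trans
    (integral_abs_re_conj_mul_fderiv_sub_le hv Φ Ψ p hΦ hQ)

end TwoStates

end Literature.MathematicalPhysics.QuantumManyBody.BoseGas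

end
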